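import Literature.AlgebraicGeometry.Milne1999.LefschetzGroupFamilyStructure
import Literature.AlgebraicGeometry.Milne1999.LefschetzCentraliserCM
import Literature.AlgebraicGeometry.HodgeTheory.MumfordTateGroupExteriorAction
import Literature.AlgebraicGeometry.Deligne1982.ProductPolarizationKaehlerCM
import Literature.AlgebraicGeometry.ComplexMultiplication.RosatiPolarizationCM
import Literature.AlgebraicGeometry.Motives.HodgeStructureOfCMType
import HarnessLib

/-!
# The Lefschetz group of a CM abelian variety is the torus `T^Ψ` (Milne 1999b, Prop. 2.5), on `ℂ`-points and on
# the family carriers: `ker l(A)(ℂ) ≅ (ℂˣ)^Φ`, `L(A)(ℂ) ≅ (ℂˣ)^Φ × ℂˣ`, `(C(A) ⊗ ℂ)^× ≅ (ℂˣ)^{Hom(K, ℂ)}`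

Family `hodge`, layer `Literature/AlgebraicGeometry/Milne1999`, namespace `Literature.AlgebraicGeometry.Milne1999`.
THEOREMS ONLY (no definition, no named fact; D-0026 net debt 0).  Sequel of `Milne1999/LefschetzCentraliserCM` (the
eigenvalue calculus of `C(A)`, `S(A)(h)`, `G(A)(h)` on a CM eigenbasis: `exists_eigenvalues_of_mem_centralizerGroup`,
`mem_unitaryCentralizerGroup_of_eigenvalues`, `eigenvalue_mul_conjugate_eq_one_of_mem_unitaryCentralizerGroup`, …) and of
`Milne1999/LefschetzGroupFamilyStructure` (Thm. 4.4 on the family carriers: `g ∈ ker l(A)(ℂ) ↔ g₁ ∈ S(A)(h)(ℂ) ∧ g = (⋀ᵏg₁)_k`,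
`lefschetzGroup_ext_one'`).  Here the two are composed into Milne's description of the Lefschetz group of an abelian
variety of CM-type as a TORUS, for a realisation `(A, ι, θ)` of a CM type `(K; Φ)` read on `H¹`
(`ComplexMultiplication.IsCMTypeRealisation Φ A ι θ`) with `θ(K) ⊆ C(A)` (hypothesis `hθ`; automatic when `End(A)` is
commutative, `IsCMTypeRealisation.theta_mem_centralizerAlgebra_of_comm`, e.g. `A` simple with `End⁰(A) = K`), and a
`θ`-eigenbasis `v = (v_σ)_{σ : K → ℂ}` of `H¹(A(ℂ); ℂ)` (`θ(a) v_σ = σ(a) v_σ`; one exists,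
`Deligne1982.exists_eigenbasis_of_isCMTypeRealisation`):

* §1 **`(C(A) ⊗ ℂ)^× = (E ⊗ ℂ)^× ≅ (ℂˣ)^{Hom(K,ℂ)}`**: the elements of `centralizerGroup A` are exactly the automorphisms
  diagonal on `v` with unit eigenvalues (`exists_units_eigenvalues_of_mem_centralizerGroup`,
  `mem_centralizerGroup_of_apply_basis_eq_smul`), whence a group isomorphism `centralizerGroup A ≃* ((K →+* ℂ) → ℂˣ)`
  (`nonempty_centralizerGroup_mulEquiv_pi_units`) — Milne's «`C₀(A) ⊗_ℚ Q → C(A)` is an isomorphism» on units.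
* §2 **`ker l(A)(ℂ) = T¹(ℂ) = {d ∈ (ℂˣ)^{Hom(K,ℂ)} | d_σ d_σ̄ = 1} ≅ (ℂˣ)^Φ ≅ (ℂˣ)^{dim A}`**: an element `g` of the special
  Lefschetz group is diagonal on `v` in degree one with eigenvalues `d_σ`, `d_σ d_σ̄ = 1`
  (`exists_eigenvalues_of_mem_specialLefschetzGroup`); conversely every such `d` is the degree-one eigenvalue system of a
  unique `g ∈ ker l(A)(ℂ)` (`mem_map_specialLefschetzGroup_one_iff_of_eigenvalues`,
  `existsUnique_mem_specialLefschetzGroup_of_eigenvalues`), the eigenvalues on `Φ` are free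
  (`existsUnique_mem_specialLefschetzGroup_of_cmType`), and
  **`specialLefschetzGroup (dim A) A.X ≃* (Φ → ℂˣ) ≃* (Fin (dim A) → ℂˣ)`** (`nonempty_specialLefschetzGroup_mulEquiv_pi_units`,
  `nonempty_specialLefschetzGroup_mulEquiv_fin`) — «`S(A)` is a torus […] the character group of `S(A)` is the quotient
  of `⊕ ℤξ_σ` by the subgroup generated by the elements `ξ_σ + ξ_{ισ}`» (1999a p. 657), of dimension `g = |Φ|`.
* §3 **`L(A)(ℂ) = T^Ψ(ℂ) = {d | d_σ d_σ̄ = c independent of σ} ≅ (ℂˣ)^Φ × ℂˣ`**: for `g ∈ L(A)(ℂ)`, `g₁` is diagonal with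
  `d_σ d_σ̄ = c ∈ ℂˣ` constant (`exists_eigenvalues_multiplier_of_mem_lefschetzGroup`), `c` being Milne's multiplier
  `l(g)` (`Q_h(g₁x, g₁y) = c · Q_h(x, y)` for every Rosati-compatible `h`, `polarizationPairingOne_eq_multiplier_smul_of_mem_lefschetzGroup`);
  conversely (`mem_map_lefschetzGroup_one_iff_of_eigenvalues` — verbatim «`L(A_Ψ)(ℚ) = {α ∈ E_ψ^× | α · ια ∈ ℚ^×}` and its
  canonical character `l(A_Ψ)` sends `α` to `α · ια`» read over `ℂ`), uniqueness given `(d|_Φ, c)`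
  (`existsUnique_mem_lefschetzGroup_of_cmType`) and **`lefschetzGroup (dim A) A.X ≃* (Φ → ℂˣ) × ℂˣ`**
  (`nonempty_lefschetzGroup_mulEquiv_pi_units_prod`, `nonempty_lefschetzGroup_mulEquiv_fin_prod`): `L(A_Ψ) = T^Ψ`, a torus
  of dimension `g + 1`.
* §0 supplies, from Shimura's Thm. 4 (3) as already in the tree (`IsCMTypeRealisation.exists_rosati_kaehlerClass_full`), a
  polarization class `h` (`IsPolarizationClass`, via `Deligne1982.isPolarizationClass_of_isKaehlerClass_smul`) whose Rosati
  involution is complex conjugation on `K` (`IsCMTypeRealisation.exists_isPolarizationClass_rosati`) — the only place a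
  polarization enters; all statements about `ker l`, `L`, `C(A)^×` are polarization-free.

## Sources read, verbatim

* J. S. Milne, *Lefschetz motives and the Tate conjecture*, Compositio Math. 117 (1999) 47–81
  [`paper:doi-10-1023-a-1000776613765`], §2 Prop. 2.5 and proof (held p0012 L8–L14): «PROPOSITION 2.5. For any `Ψ`,
  `(L(A_Ψ), l(A_Ψ)) = (T^Ψ, t^Ψ)`. Proof. Choose a `ψ ∈ Ψ`. […] Then `L(A_Ψ)` is the subtorus of `(𝔾_m)_{E_ψ/ℚ}` such that
  `L(A_Ψ)(ℚ) = {α ∈ E_ψ^× | α · ια ∈ ℚ^×}` and its canonical character `l(A_Ψ)` sends `α` to `α · ια`»; §1 Rem. 1.10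
  (p. 53): «the canonical map `C₀(A) ⊗_ℚ Q → C(A)` is an isomorphism […] `L(A) ≅ L₀(A)_{/Q}` where
  `L₀(A)(R) = {(γ, c) ∈ C₀(A)^× × R^× | γ†γ = c}`»; §1 p. 52: `S(A)(R) = {γ ∈ C(A) ⊗ R | γ†γ = 1}`.
* J. S. Milne, *Lefschetz classes on abelian varieties*, Duke Math. J. 96 (1999) 639–675
  [`paper:doi-10-1215-s0012-7094-99-09620-5`], §3 p. 657 (held p0019 L30–L36): «`K` is a CM-field, and `S(A)` is a torus.
  Every embedding `σ : K ↪ k^al` defines a character `ξ_σ` of `S(A)`, and the character group of `S(A)` is the quotient of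
  `⊕ ℤξ_σ` by the subgroup generated by the elements `ξ_σ + ξ_{ισ}`. Lemma 2.1 shows that `H¹(A^r) ⊗ k^al` is a free
  `K ⊗_ℚ k^al`-module. Therefore the weights of `S(A)` in `H¹(A) ⊗ k^al` are precisely the characters `ξ_σ`»; §1 p. 645
  («`S₀(A)(R) = {γ ∈ C₀(A) ⊗_ℚ R | γ†γ = 1}`»); §4 Def. 4.3, Thm. 4.4, p. 659.
* P. Deligne, *Hodge cycles on abelian varieties*, LNM 900 (1982), I §5 proof of Prop. 5.1: «`μ(𝔾_m) ⊂ (E ⊗ ℝ)^×` and so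
  the Mumford-Tate group of `A` is contained in `E^×`»; Example 3.7 (`H¹ = ⊕_σ H¹_σ`).
* G. Shimura, *Abelian Varieties with Complex Multiplication and Modular Functions* (1998), §6.2 Thm. 4 (3) (the Rosati
  involution of a CM abelian variety induces complex conjugation on `K`).

## Proof sketch (as printed, on the carriers)

`C(A) ⊗ ℂ = C(E) = E ⊗ ℂ` is the algebra of operators diagonal on the eigenbasis (`H¹` is free of rank one over `E ⊗ ℂ`,
1999a Lemma 2.1; the tree's `exists_apply_eq_smul_of_mem_centralizer_range`, `centralizer_range_le_centralizerAlgebra`), so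
`(C(A) ⊗ ℂ)^× = {diag(d_σ)} ≅ (ℂˣ)^{Hom(K,ℂ)}`.  For a Rosati-compatible polarization `Q_h(v_σ, v_τ) = 0` unless `τ = σ̄`, so
`diag(d)` multiplies `Q_h` by `c` iff `d_σ d_σ̄ = c` for all `σ` (`†` = complex conjugation): `S(A)(h)(ℂ) = {d_σ d_σ̄ = 1}`,
`G(A)(h)(ℂ) = {d_σ d_σ̄ = c}`; by Thm. 4.4 on the carriers these are `ker l(A)(ℂ)|_{H¹}`, `L(A)(ℂ)|_{H¹}`, and `g ↦ g₁` is
injective.  A CM type `Φ` picks one of each pair `{σ, σ̄}`, so `d ↦ d|_Φ` (resp. `(d|_Φ, c)`) is an isomorphism onto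
`(ℂˣ)^Φ` (resp. `(ℂˣ)^Φ × ℂˣ`), with inverse `e ↦ (e_φ on Φ, e_φ̄⁻¹ on Φ̄)` (resp. `c e_φ̄⁻¹ on Φ̄`).

## What is NOT here

* The tori as algebraic groups over `ℚ`, `X^*(T^Ψ)`, Thm. 2.6; the other carrier `Geometry/Kaehler/…LefschetzGroupC` and
  `ComplexMultiplication/MumfordTateTorusAbelianVarietyLefschetzGroupConnected` (complex tori) are not touched.
* `MT(A)(ℂ)`, `Hg(A)(ℂ)` sit inside these tori (`L(A) ⊃ Hg(A)`) as the images of Deligne's torus; their exact description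
  (the reflex norm / Kubota rank) is `HodgeTheory/CMBettiHodgeGroupSplitTorus` on yet another carrier and is not repeated.

## References

* [Milne1999] J. S. Milne, Lefschetz motives and the Tate conjecture, Compositio Math. 117 (1999) 47–81: §1 p. 52–53
  (Rem. 1.10), §2 Prop. 2.5.
* [Milne1999LefschetzClasses] J. S. Milne, Lefschetz classes on abelian varieties, Duke Math. J. 96 (1999) 639–675: §1
  p. 645, §2 Lemma 2.1, §3 p. 657, §4 Def. 4.3, Thm. 4.4, p. 659.
* [Deligne1982HodgeCycles] P. Deligne, Hodge cycles on abelian varieties, LNM 900 (1982), I Example 3.7, §5 Prop. 5.1.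
* [Shimura1998] G. Shimura, Abelian Varieties with Complex Multiplication and Modular Functions (1998), §6.2 Thm. 4.
-/

noncomputable section

open CategoryTheory NumberField
open Literature.AlgebraicTopology.SingularHomology
open Literature.AlgebraicGeometry.HodgeTheory
open Literature.AlgebraicGeometry.Motives
open Literature.AlgebraicGeometry.VanGeemen1994 (pullbackOne)
open Literature.AlgebraicGeometry.ComplexMultiplication (IsCMTypeRealisation)
open NumberField.ComplexEmbedding (conjugate)

namespace Literature.AlgebraicGeometry.Milne1999

variable {K : Type} [Field K] [NumberField K] {Φ : CMType K} {A : AbelianVariety ℂ}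
  {ι : 𝓞 K →+* End A} {θ : K →+* Module.End ℂ (complexBetti A.X 1)}
  {v : Module.Basis (K →+* ℂ) ℂ (complexBetti A.X 1)}

/-! ### §0 Bookkeeping: dimension, the `ι`-form of the eigenbasis, a Rosati polarization class, diagonal automorphisms -/

section Bookkeeping

omit [NumberField K] in
/-- `φ ∈ Φ ⟹ φ̄ ∉ Φ`. [folklore] -/
private theorem conjugate_not_mem_of_mem (Φ : CMType K) {φ : K →+* ℂ} (h : φ ∈ Φ.1) : conjugate φ ∉ Φ.1 :=
  (Φ.2 φ).1 h

omit [NumberField K] in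
/-- `σ ∉ Φ ⟹ σ̄ ∈ Φ` (a CM type contains exactly one of `σ, σ̄`). [folklore] -/
private theorem conjugate_mem_of_not_mem (Φ : CMType K) {σ : K →+* ℂ} (h : σ ∉ Φ.1) : conjugate σ ∈ Φ.1 := by
  by_contra h'
  exact h ((Φ.2 σ).2 h')

/-- A realisation has positive dimension (`dim_ℂ H¹ = [K:ℚ] ≥ 1`). [folklore] -/
private theorem one_le_dim (hA : IsCMTypeRealisation Φ A ι θ) : 1 ≤ A.dim := by
  have h1 := AbelianVariety.finrank_complexBetti_one A
  rw [hA.2.1] at h1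
  have h2 : 0 < Module.finrank ℚ K := Module.finrank_pos
  omega

/-- `|Φ| = dim A` (`2|Φ| = [K:ℚ] = dim H¹ = 2 dim A`). [cite: Deligne1982HodgeCycles, Example 3.7] -/
theorem _root_.Literature.AlgebraicGeometry.ComplexMultiplication.IsCMTypeRealisation.ncard_cmType_eq_dim
    (hA : IsCMTypeRealisation Φ A ι θ) : Φ.1.ncard = A.dim := by
  have h1 := AbelianVariety.finrank_complexBetti_one A
  have h2 := HodgeStructure.two_mul_ncard_cmType_eq_finrank Φ
  rw [hA.2.1] at h1
  omega

/-- The `ι`-form of a `θ`-eigenbasis: `ι(a)^* v_σ = σ(a) v_σ` on `𝓞_K` (`θ(a) = ι(a)^*`). [cite: Deligne1982HodgeCycles, §4 p. 32] -/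
theorem _root_.Literature.AlgebraicGeometry.ComplexMultiplication.IsCMTypeRealisation.map_ringOfIntegers_basis_eq_smul
    (hA : IsCMTypeRealisation Φ A ι θ) (hv : ∀ (σ : K →+* ℂ) (a : K), θ a (v σ) = σ a • v σ) (σ : K →+* ℂ) (a : 𝓞 K) :
    complexBetti.map (ι a).hom.hom.hom 1 (v σ) = σ (a : K) • v σ := by
  rw [← hv σ (a : K), ← hA.2.2.1 a]

/-- **A CM realisation carries a polarization class whose Rosati involution is complex conjugation on `K`**
(`IsPolarizationClass`: rational, supported on a divisor, hard Lefschetz — from Shimura's Riemann form of §6.2 Thm. 4 as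
recorded by `IsCMTypeRealisation.exists_rosati_kaehlerClass_full`, a rational class with a non-zero real Kähler multiple).
[cite: Shimura1998, §6.2 Thm. 4 (3)] [cite: Deligne1982HodgeCycles, §5 Prop. 5.1] -/
theorem _root_.Literature.AlgebraicGeometry.ComplexMultiplication.IsCMTypeRealisation.exists_isPolarizationClass_rosati
    [IsCMField K] (hA : IsCMTypeRealisation Φ A ι θ) :
    ∃ h : complexBetti A.X 2, IsPolarizationClass A.dim A.X h ∧
      ∀ (a ac : 𝓞 K), (ac : K) = IsCMField.complexConj K (a : K) → ∀ x y : complexBetti A.X 1,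
        polarizationPairingOne A.X h (A.dim - 1) (complexBetti.map (ι a).hom.hom.hom 1 x) y =
          polarizationPairingOne A.X h (A.dim - 1) x (complexBetti.map (ι ac).hom.hom.hom 1 y) := by
  obtain ⟨h, hQ, -, hK, -, -, hros⟩ := hA.exists_rosati_kaehlerClass_full
  exact ⟨h, Deligne1982.isPolarizationClass_of_isKaehlerClass_smul hQ hK, hros⟩

omit [NumberField K] in
/-- **The diagonal torus action on the eigenbasis**: a group homomorphism `(ℂˣ)^{Hom(K,ℂ)} → GL(H¹(A(ℂ); ℂ))`,
`d ↦ diag(d_σ)` (`Module.Basis.unitsSMul`). [cite: Milne1999LefschetzClasses, §3 p. 657 (weights ξ_σ)] -/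
theorem exists_eigenbasisDiagonalHom (v : Module.Basis (K →+* ℂ) ℂ (complexBetti A.X 1)) :
    ∃ D : ((K →+* ℂ) → ℂˣ) →* (complexBetti A.X 1 ≃ₗ[ℂ] complexBetti A.X 1),
      ∀ (d : (K →+* ℂ) → ℂˣ) (σ : K →+* ℂ), D d (v σ) = (d σ : ℂ) • v σ := by
  have key : ∀ (d : (K →+* ℂ) → ℂˣ) (σ : K →+* ℂ),
      v.equiv (v.unitsSMul d) (Equiv.refl _) (v σ) = (d σ : ℂ) • v σ := fun d σ ↦ by
    rw [Module.Basis.equiv_apply, Equiv.refl_apply, Module.Basis.unitsSMul_apply, Units.smul_def]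
  refine ⟨{ toFun := fun d ↦ v.equiv (v.unitsSMul d) (Equiv.refl _)
            map_one' := v.ext' fun σ ↦ ?_
            map_mul' := fun d d' ↦ v.ext' fun σ ↦ ?_ }, fun d σ ↦ key d σ⟩
  · rw [key, Pi.one_apply, Units.val_one, one_smul]
    rfl
  · rw [key, LinearEquiv.mul_apply, key, map_smul, key, smul_smul, Pi.mul_apply, Units.val_mul, mul_comm]

omit [NumberField K] in
/-- Eigenvalues on a basis determine the automorphism. [folklore] -/
private theorem eq_of_apply_basis_eq_smul {u u' : complexBetti A.X 1 ≃ₗ[ℂ] complexBetti A.X 1} {d : (K →+* ℂ) → ℂ}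
    (hd : ∀ σ, u (v σ) = d σ • v σ) (hd' : ∀ σ, u' (v σ) = d σ • v σ) : u = u' :=
  v.ext' fun σ ↦ by rw [hd, hd']

omit [NumberField K] in
/-- Equal diagonal automorphisms have equal eigenvalues. [folklore] -/
private theorem eigenvalue_eq_of_eq {u : complexBetti A.X 1 ≃ₗ[ℂ] complexBetti A.X 1} {d d' : (K →+* ℂ) → ℂ}
    (hd : ∀ σ, u (v σ) = d σ • v σ) (hd' : ∀ σ, u (v σ) = d' σ • v σ) (σ : K →+* ℂ) : d σ = d' σ :=
  smul_left_injective ℂ (v.ne_zero σ) ((hd σ).symm.trans (hd' σ))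

/-- The scalar automorphism `c · id`, evaluated. [folklore] -/
private theorem smulOfUnit_apply_eq (c : ℂˣ) (x : complexBetti A.X 1) : LinearEquiv.smulOfUnit c x = (c : ℂ) • x := by
  simp [LinearEquiv.smulOfUnit, Units.smul_def]

end Bookkeeping

/-! ### §1 `(C(A) ⊗ ℂ)^× = (E ⊗ ℂ)^×`: the unit group of the centraliser is the diagonal torus `(ℂˣ)^{Hom(K,ℂ)}` -/

section Centralizer

/-- **A diagonal automorphism lies in `(C(A) ⊗ ℂ)^×`** when `θ(K) ⊆ C(A)`: it commutes with `θ(K)` (both diagonal on `v`),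
hence lies in `C(E) = C(A)` (`centralizer_range_le_centralizerAlgebra`). [cite: Milne1999, §1 Rem. 1.10 (p. 53)]
[cite: Milne1999LefschetzClasses, §2 Prop. 2.1] -/
theorem mem_centralizerGroup_of_apply_basis_eq_smul (hA : IsCMTypeRealisation Φ A ι θ)
    (hθ : ∀ a : K, θ a ∈ centralizerAlgebra A) (hv : ∀ (σ : K →+* ℂ) (a : K), θ a (v σ) = σ a • v σ)
    {u : complexBetti A.X 1 ≃ₗ[ℂ] complexBetti A.X 1} {d : (K →+* ℂ) → ℂ} (hd : ∀ σ, u (v σ) = d σ • v σ) :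
    u ∈ centralizerGroup A := by
  refine mem_centralizerGroup_iff_coe_mem.2 (hA.centralizer_range_le_centralizerAlgebra hθ ?_)
  rw [Subalgebra.mem_centralizer_iff]
  rintro _ ⟨a, rfl⟩
  refine v.ext fun σ ↦ ?_
  rw [Module.End.mul_apply, Module.End.mul_apply, LinearEquiv.coe_coe, hd, map_smul, hv, map_smul, hd, smul_comm]

/-- **Every element of `(C(A) ⊗ ℂ)^×` is diagonal on the eigenbasis with UNIT eigenvalues** (`u v_σ = d_σ v_σ`, `d_σ ≠ 0`).
[cite: Milne1999, §1 Rem. 1.10 (p. 53)] [cite: Milne1999LefschetzClasses, §2 Prop. 2.1] -/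
theorem _root_.Literature.AlgebraicGeometry.ComplexMultiplication.IsCMTypeRealisation.exists_units_eigenvalues_of_mem_centralizerGroup
    (hA : IsCMTypeRealisation Φ A ι θ) (hv : ∀ (σ : K →+* ℂ) (a : K), θ a (v σ) = σ a • v σ)
    {u : complexBetti A.X 1 ≃ₗ[ℂ] complexBetti A.X 1} (hu : u ∈ centralizerGroup A) :
    ∃ d : (K →+* ℂ) → ℂˣ, ∀ σ, u (v σ) = (d σ : ℂ) • v σ := by
  obtain ⟨d, hd⟩ := hA.exists_eigenvalues_of_mem_centralizerGroup hv hu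
  have hd0 : ∀ σ, d σ ≠ 0 := fun σ h0 ↦ by
    have e := hd σ
    rw [h0, zero_smul, LinearEquiv.map_eq_zero_iff] at e
    exact v.ne_zero σ e
  exact ⟨fun σ ↦ Units.mk0 (d σ) (hd0 σ), fun σ ↦ by rw [Units.val_mk0, hd]⟩

/-- **`(C(A) ⊗ ℂ)^× ≅ (ℂˣ)^{Hom(K,ℂ)}` as groups** (`θ(K) ⊆ C(A)`): «the canonical map `C₀(A) ⊗_ℚ Q → C(A)` is an
isomorphism», `C₀(A) = K`, `K ⊗ ℂ = ℂ^{Hom(K,ℂ)}`, read on units. [cite: Milne1999, §1 Rem. 1.10 (p. 53)]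
[cite: Milne1999LefschetzClasses, §2 Prop. 2.1 and §3 p. 657] -/
theorem nonempty_centralizerGroup_mulEquiv_pi_units (hA : IsCMTypeRealisation Φ A ι θ)
    (hθ : ∀ a : K, θ a ∈ centralizerAlgebra A) : Nonempty (centralizerGroup A ≃* ((K →+* ℂ) → ℂˣ)) := by
  obtain ⟨v, hv, -⟩ := Deligne1982.exists_eigenbasis_of_isCMTypeRealisation hA
  obtain ⟨D, hD⟩ := exists_eigenbasisDiagonalHom v
  let F : ((K →+* ℂ) → ℂˣ) →* centralizerGroup A :=
    D.codRestrict _ fun d ↦ mem_centralizerGroup_of_apply_basis_eq_smul hA hθ hv (hD d)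
  refine ⟨(MulEquiv.ofBijective F ⟨fun d d' e ↦ funext fun σ ↦ Units.ext ?_, fun u ↦ ?_⟩).symm⟩
  · have e1 : D d = D d' := congrArg Subtype.val e
    exact eigenvalue_eq_of_eq (hD d) (fun σ ↦ by rw [e1, hD]) σ
  · obtain ⟨d, hd⟩ := hA.exists_units_eigenvalues_of_mem_centralizerGroup hv u.2
    exact ⟨d, Subtype.ext (eq_of_apply_basis_eq_smul (hD d) hd)⟩

end Centralizer

/-! ### §2 `ker l(A)(ℂ)` is the norm-one torus `{d | d_σ d_σ̄ = 1} ≅ (ℂˣ)^Φ` -/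

section SpecialLefschetz

variable [IsCMField K]

/-- **The degree-one component of `g ∈ ker l(A)(ℂ)` is diagonal on the eigenbasis with `d_σ d_σ̄ = 1`**
(`ker l(A)|_{H¹} ≤ S(A)(h)(ℂ) ⊆ (C(A) ⊗ ℂ)^×` for a Rosati polarization class `h`: diagonal by §1, unitary because
`Q_h(v_σ, v_σ̄) ≠ 0` is preserved; «`S₀(A)(R) = {γ ∈ C₀(A) ⊗ R | γ†γ = 1}`», `†` = complex conjugation). No hypothesis on
`θ(K)`. [cite: Milne1999LefschetzClasses, §1 p. 645 (S₀(A)), §3 p. 657, Thm. 4.4] [cite: Milne1999, §2 Prop. 2.5 (proof)] -/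
theorem exists_eigenvalues_of_mem_specialLefschetzGroup (hA : IsCMTypeRealisation Φ A ι θ)
    (hv : ∀ (σ : K →+* ℂ) (a : K), θ a (v σ) = σ a • v σ)
    {g : ∀ k : ℕ, complexBetti A.X k ≃ₗ[ℂ] complexBetti A.X k} (hg : g ∈ specialLefschetzGroup A.dim A.X) :
    ∃ d : (K →+* ℂ) → ℂˣ, (∀ σ, g 1 (v σ) = (d σ : ℂ) • v σ) ∧ ∀ σ, (d σ : ℂ) * d (conjugate σ) = 1 := by
  obtain ⟨h, hpol, hros⟩ := hA.exists_isPolarizationClass_rosati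
  have hA1 := one_le_dim hA
  have hg1 : g 1 ∈ unitaryCentralizerGroup A h :=
    (hpol.specialLefschetzGroup_map_one_eq hA1).le ⟨g, hg, rfl⟩
  obtain ⟨d, hd⟩ := hA.exists_units_eigenvalues_of_mem_centralizerGroup hv (unitaryCentralizerGroup_le_centralizerGroup hg1)
  refine ⟨d, hd, fun σ ↦ ?_⟩
  exact eigenvalue_mul_conjugate_eq_one_of_mem_unitaryCentralizerGroup (hA.map_ringOfIntegers_basis_eq_smul hv) hros
    (fun x hx ↦ eq_zero_of_forall_polarizationPairingOne_eq_zero_of_hasHardLefschetzProperty hA1 hpol.hasHardLefschetz hx)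
    hg1 hd σ

/-- The eigenvalues of `g ∈ ker l(A)(ℂ)` in ANY diagonal presentation satisfy `d_σ d_σ̄ = 1`. [cite: Milne1999LefschetzClasses, §1 p. 645 and §3 p. 657] -/
theorem eigenvalue_mul_conjugate_eq_one_of_mem_specialLefschetzGroup (hA : IsCMTypeRealisation Φ A ι θ)
    (hv : ∀ (σ : K →+* ℂ) (a : K), θ a (v σ) = σ a • v σ)
    {g : ∀ k : ℕ, complexBetti A.X k ≃ₗ[ℂ] complexBetti A.X k} (hg : g ∈ specialLefschetzGroup A.dim A.X)
    {d : (K →+* ℂ) → ℂ} (hd : ∀ σ, g 1 (v σ) = d σ • v σ) (σ : K →+* ℂ) : d σ * d (conjugate σ) = 1 := by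
  obtain ⟨d', hd', h1⟩ := exists_eigenvalues_of_mem_specialLefschetzGroup hA hv hg
  rw [eigenvalue_eq_of_eq hd hd' σ, eigenvalue_eq_of_eq hd hd' (conjugate σ)]
  exact h1 σ

/-- **Conversely, a diagonal automorphism with `d_σ d_σ̄ = 1` is the degree-one component of an element of `ker l(A)(ℂ)`**
(`θ(K) ⊆ C(A)`: diagonal ⟹ in `C(A)^×`; `d_σ d_σ̄ = 1` ⟹ preserves the Rosati polarization `Q_h`; Thm. 4.4).
[cite: Milne1999LefschetzClasses, §1 p. 645, Thm. 4.4 (p. 659)] [cite: Milne1999, §2 Prop. 2.5 (proof)] -/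
theorem mem_map_specialLefschetzGroup_one_of_eigenvalues (hA : IsCMTypeRealisation Φ A ι θ)
    (hθ : ∀ a : K, θ a ∈ centralizerAlgebra A) (hv : ∀ (σ : K →+* ℂ) (a : K), θ a (v σ) = σ a • v σ)
    {u : complexBetti A.X 1 ≃ₗ[ℂ] complexBetti A.X 1} {d : (K →+* ℂ) → ℂ} (hd : ∀ σ, u (v σ) = d σ • v σ)
    (h1 : ∀ σ, d σ * d (conjugate σ) = 1) :
    u ∈ (specialLefschetzGroup A.dim A.X).map
      (Pi.evalMonoidHom (fun k : ℕ ↦ complexBetti A.X k ≃ₗ[ℂ] complexBetti A.X k) 1) := by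
  obtain ⟨h, hpol, hros⟩ := hA.exists_isPolarizationClass_rosati
  rw [hpol.specialLefschetzGroup_map_one_eq (one_le_dim hA)]
  exact mem_unitaryCentralizerGroup_of_eigenvalues (hA.map_ringOfIntegers_basis_eq_smul hv) hros
    (mem_centralizerGroup_of_apply_basis_eq_smul hA hθ hv hd) hd h1

/-- **Milne 1999b Prop. 2.5 for `ker l` on `ℂ`-points, `S(A) = {γ | γ†γ = 1}`**: a diagonal automorphism `u = diag(d_σ)` of
`H¹(A(ℂ); ℂ)` is the degree-one component of an element of `ker l(A)(ℂ)` iff `d_σ d_σ̄ = 1` for all `σ` (`θ(K) ⊆ C(A)`).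
[cite: Milne1999, §1 p. 52 (S(A)) and §2 Prop. 2.5] [cite: Milne1999LefschetzClasses, §1 p. 645, §3 p. 657, Thm. 4.4] -/
theorem mem_map_specialLefschetzGroup_one_iff_of_eigenvalues (hA : IsCMTypeRealisation Φ A ι θ)
    (hθ : ∀ a : K, θ a ∈ centralizerAlgebra A) (hv : ∀ (σ : K →+* ℂ) (a : K), θ a (v σ) = σ a • v σ)
    {u : complexBetti A.X 1 ≃ₗ[ℂ] complexBetti A.X 1} {d : (K →+* ℂ) → ℂ} (hd : ∀ σ, u (v σ) = d σ • v σ) :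
    u ∈ (specialLefschetzGroup A.dim A.X).map
        (Pi.evalMonoidHom (fun k : ℕ ↦ complexBetti A.X k ≃ₗ[ℂ] complexBetti A.X k) 1) ↔
      ∀ σ, d σ * d (conjugate σ) = 1 := by
  refine ⟨?_, mem_map_specialLefschetzGroup_one_of_eigenvalues hA hθ hv hd⟩
  rintro ⟨g, hg, rfl⟩ σ
  exact eigenvalue_mul_conjugate_eq_one_of_mem_specialLefschetzGroup hA hv hg hd σ

/-- **Every unitary eigenvalue system is realised by exactly one element of `ker l(A)(ℂ)`** (existence: the diagonal
automorphism and Thm. 4.4; uniqueness: `ker l` is faithful on `H¹`, `specialLefschetzGroup_ext_one`).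
[cite: Milne1999, §2 Prop. 2.5] [cite: Milne1999LefschetzClasses, Thm. 4.4 and §1 p. 644] -/
theorem existsUnique_mem_specialLefschetzGroup_of_eigenvalues (hA : IsCMTypeRealisation Φ A ι θ)
    (hθ : ∀ a : K, θ a ∈ centralizerAlgebra A) (hv : ∀ (σ : K →+* ℂ) (a : K), θ a (v σ) = σ a • v σ)
    (d : (K →+* ℂ) → ℂˣ) (h1 : ∀ σ, (d σ : ℂ) * d (conjugate σ) = 1) :
    ∃! g : ∀ k : ℕ, complexBetti A.X k ≃ₗ[ℂ] complexBetti A.X k,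
      g ∈ specialLefschetzGroup A.dim A.X ∧ ∀ σ, g 1 (v σ) = (d σ : ℂ) • v σ := by
  obtain ⟨D, hD⟩ := exists_eigenbasisDiagonalHom v
  obtain ⟨g, hg, hg1⟩ := mem_map_specialLefschetzGroup_one_of_eigenvalues hA hθ hv (hD d) h1
  refine ⟨g, ⟨hg, fun σ ↦ by rw [show g 1 = D d from hg1, hD]⟩, ?_⟩
  rintro g' ⟨hg', hd'⟩
  refine specialLefschetzGroup_ext_one hg' hg ?_
  rw [show g 1 = D d from hg1]
  exact eq_of_apply_basis_eq_smul hd' (hD d)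

/-- **The eigenvalues on `Φ` are free coordinates on `ker l(A)(ℂ)`**: for every `e : Φ → ℂˣ` there is exactly one
`g ∈ ker l(A)(ℂ)` with `g₁ v_φ = e_φ v_φ` for `φ ∈ Φ` (then `g₁ v_φ̄ = e_φ⁻¹ v_φ̄`): «the character group of `S(A)` is the
quotient of `⊕ ℤξ_σ` by the subgroup generated by the elements `ξ_σ + ξ_{ισ}`» — a CM type is a basis of it.
[cite: Milne1999LefschetzClasses, §3 p. 657] [cite: Milne1999, §2 Prop. 2.5] -/
theorem existsUnique_mem_specialLefschetzGroup_of_cmType (hA : IsCMTypeRealisation Φ A ι θ)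
    (hθ : ∀ a : K, θ a ∈ centralizerAlgebra A) (hv : ∀ (σ : K →+* ℂ) (a : K), θ a (v σ) = σ a • v σ) (e : Φ.1 → ℂˣ) :
    ∃! g : ∀ k : ℕ, complexBetti A.X k ≃ₗ[ℂ] complexBetti A.X k,
      g ∈ specialLefschetzGroup A.dim A.X ∧ ∀ φ : Φ.1, g 1 (v φ) = (e φ : ℂ) • v φ := by
  classical
  -- the unitary extension of `e` to all embeddings
  let d : (K →+* ℂ) → ℂˣ := fun σ ↦
    if hσ : σ ∈ Φ.1 then e ⟨σ, hσ⟩ else (e ⟨conjugate σ, conjugate_mem_of_not_mem Φ hσ⟩)⁻¹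
  have hdΦ : ∀ φ : Φ.1, d φ = e φ := fun φ ↦ by
    simp only [d, dif_pos φ.2]
  have hdc : ∀ (φ : K →+* ℂ) (hφ : φ ∈ Φ.1), d (conjugate φ) = (e ⟨φ, hφ⟩)⁻¹ := fun φ hφ ↦ by
    simp only [d, dif_neg (conjugate_not_mem_of_mem Φ hφ)]
    congr 3
    exact NumberField.ComplexEmbedding.involutive_conjugate K φ
  have h1 : ∀ σ, (d σ : ℂ) * d (conjugate σ) = 1 := fun σ ↦ by
    by_cases hσ : σ ∈ Φ.1
    · rw [hdc σ hσ, show d σ = e ⟨σ, hσ⟩ from hdΦ ⟨σ, hσ⟩, ← Units.val_mul, mul_inv_cancel, Units.val_one]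
    · have hσ' := conjugate_mem_of_not_mem Φ hσ
      have e1 : d σ = (e ⟨conjugate σ, hσ'⟩)⁻¹ := by simp only [d, dif_neg hσ]
      rw [e1, show d (conjugate σ) = e ⟨conjugate σ, hσ'⟩ from hdΦ ⟨conjugate σ, hσ'⟩, ← Units.val_mul,
        inv_mul_cancel, Units.val_one]
  obtain ⟨g, ⟨hg, hgd⟩, huniq⟩ := existsUnique_mem_specialLefschetzGroup_of_eigenvalues hA hθ hv d h1
  refine ⟨g, ⟨hg, fun φ ↦ by rw [hgd, hdΦ]⟩, ?_⟩
  rintro g' ⟨hg', he'⟩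
  -- `g'` is diagonal with unitary eigenvalues `d'` agreeing with `e` on `Φ`, hence `d' = d`
  obtain ⟨d', hd', h1'⟩ := exists_eigenvalues_of_mem_specialLefschetzGroup hA hv hg'
  refine huniq g' ⟨hg', fun σ ↦ ?_⟩
  rw [hd']
  congr 2
  by_cases hσ : σ ∈ Φ.1
  · have e1 := he' ⟨σ, hσ⟩
    rw [hd'] at e1
    exact (Units.ext (smul_left_injective ℂ (v.ne_zero σ) e1)).trans (hdΦ ⟨σ, hσ⟩).symm
  · have hσ' := conjugate_mem_of_not_mem Φ hσ
    have e1 := he' ⟨conjugate σ, hσ'⟩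
    rw [hd'] at e1
    have e2 : d' (conjugate σ) = e ⟨conjugate σ, hσ'⟩ := Units.ext (smul_left_injective ℂ (v.ne_zero _) e1)
    -- `d' σ = (d' σ̄)⁻¹ = (e σ̄)⁻¹ = d σ`
    have e3 : d' σ = (d' (conjugate σ))⁻¹ := eq_inv_of_mul_eq_one_left (Units.ext (by rw [Units.val_mul]; exact h1' σ))
    rw [e3, e2]
    simp only [d, dif_neg hσ]

/-- **`ker l(A)(ℂ) ≅ (ℂˣ)^Φ` as groups — `S(A)` is a torus with character group `⊕_σ ℤξ_σ / ⟨ξ_σ + ξ_{ισ}⟩`** (Milne 1999b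
Prop. 2.5 for the kernel of `l`; 1999a p. 657), on the tree's family carrier `specialLefschetzGroup (dim A) A.X`
(`θ(K) ⊆ C(A)`, e.g. `End(A)` commutative). [cite: Milne1999, §2 Prop. 2.5] [cite: Milne1999LefschetzClasses, §3 p. 657 and Thm. 4.4] -/
theorem nonempty_specialLefschetzGroup_mulEquiv_pi_units (hA : IsCMTypeRealisation Φ A ι θ)
    (hθ : ∀ a : K, θ a ∈ centralizerAlgebra A) : Nonempty (specialLefschetzGroup A.dim A.X ≃* (Φ.1 → ℂˣ)) := by
  classical
  obtain ⟨v, hv, -⟩ := Deligne1982.exists_eigenbasis_of_isCMTypeRealisation hA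
  -- `E g φ` = the eigenvalue of `g₁` on `v_φ`
  choose G hG huniq using fun e : Φ.1 → ℂˣ ↦ existsUnique_mem_specialLefschetzGroup_of_cmType hA hθ hv e
  have hev : ∀ g ∈ specialLefschetzGroup A.dim A.X, ∃ e : Φ.1 → ℂˣ, ∀ φ : Φ.1, g 1 (v φ) = (e φ : ℂ) • v φ :=
    fun g hg ↦ by
      obtain ⟨d, hd, -⟩ := exists_eigenvalues_of_mem_specialLefschetzGroup hA hv hg
      exact ⟨fun φ ↦ d φ, fun φ ↦ hd φ⟩
  choose E hE using hev
  have hGE : ∀ g (hg : g ∈ specialLefschetzGroup A.dim A.X), G (E g hg) = g := fun g hg ↦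
    (huniq (E g hg) g ⟨hg, hE g hg⟩).symm
  -- the coordinates are determined by the eigenvalue equations
  have hcoord : ∀ (g) (hg : g ∈ specialLefschetzGroup A.dim A.X) (e : Φ.1 → ℂˣ),
      (∀ φ : Φ.1, g 1 (v φ) = (e φ : ℂ) • v φ) → E g hg = e := fun g hg e h1 ↦
    funext fun φ ↦ Units.ext (smul_left_injective ℂ (v.ne_zero φ) (((hE g hg) φ).symm.trans (h1 φ)))
  have hEG : ∀ e : Φ.1 → ℂˣ, E (G e) (hG e).1 = e := fun e ↦ hcoord _ _ e (hG e).2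
  let F : (Φ.1 → ℂˣ) →* specialLefschetzGroup A.dim A.X :=
    { toFun := fun e ↦ ⟨G e, (hG e).1⟩
      map_one' := Subtype.ext (by
        have h1 : (1 : ∀ k : ℕ, complexBetti A.X k ≃ₗ[ℂ] complexBetti A.X k) ∈ specialLefschetzGroup A.dim A.X := one_mem _
        show G 1 = 1
        rw [← hGE 1 h1]
        congr 1
        refine (hcoord 1 h1 1 fun φ ↦ ?_).symm
        show (1 : complexBetti A.X 1 ≃ₗ[ℂ] complexBetti A.X 1) (v φ) = ((1 : ℂˣ) : ℂ) • v φ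
        rw [Units.val_one, one_smul]
        rfl)
      map_mul' := fun e e' ↦ Subtype.ext (by
        have hm : G e * G e' ∈ specialLefschetzGroup A.dim A.X := mul_mem (hG e).1 (hG e').1
        show G (e * e') = G e * G e'
        rw [← hGE (G e * G e') hm]
        congr 1
        refine (hcoord _ hm (e * e') fun φ ↦ ?_).symm
        rw [Pi.mul_apply, LinearEquiv.mul_apply, (hG e').2, map_smul, (hG e).2, smul_smul, Pi.mul_apply, Units.val_mul,
          mul_comm ((e' φ : ℂˣ) : ℂ)]) }
  refine ⟨(MulEquiv.ofBijective F ⟨fun e e' h ↦ ?_, fun g ↦ ⟨E g.1 g.2, Subtype.ext (hGE g.1 g.2)⟩⟩).symm⟩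
  have h' : G e = G e' := congrArg Subtype.val h
  have key := hcoord (G e) (hG e).1 e' fun φ ↦ by rw [h']; exact (hG e').2 φ
  rwa [hEG e] at key

/-- **`ker l(A)(ℂ) ≅ (ℂˣ)^{dim A}`: the special Lefschetz group of a CM abelian variety is a torus of dimension `g`**
(`|Φ| = dim A`). [cite: Milne1999, §2 Prop. 2.5] [cite: Milne1999LefschetzClasses, §3 p. 657] -/
theorem nonempty_specialLefschetzGroup_mulEquiv_fin (hA : IsCMTypeRealisation Φ A ι θ)
    (hθ : ∀ a : K, θ a ∈ centralizerAlgebra A) : Nonempty (specialLefschetzGroup A.dim A.X ≃* (Fin A.dim → ℂˣ)) := by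
  obtain ⟨e⟩ := nonempty_specialLefschetzGroup_mulEquiv_pi_units hA hθ
  haveI : Finite Φ.1 := Set.toFinite Φ.1
  have hcard : Nat.card Φ.1 = A.dim := by rw [Nat.card_coe_set_eq, hA.ncard_cmType_eq_dim]
  exact ⟨e.trans (MulEquiv.arrowCongr ((Finite.equivFin Φ.1).trans (finCongr hcard)) (MulEquiv.refl ℂˣ))⟩

/-- `ker l(A)(ℂ)` of a CM realisation is commutative (a torus; cf. `specialLefschetzGroup_comm_iff_isOfCMType`).
[cite: Milne1999, §1 Rem. 1.10 and §2 Prop. 2.5] -/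
theorem specialLefschetzGroup_comm_of_isCMTypeRealisation (hA : IsCMTypeRealisation Φ A ι θ)
    (hθ : ∀ a : K, θ a ∈ centralizerAlgebra A) {g g' : ∀ k : ℕ, complexBetti A.X k ≃ₗ[ℂ] complexBetti A.X k}
    (hg : g ∈ specialLefschetzGroup A.dim A.X) (hg' : g' ∈ specialLefschetzGroup A.dim A.X) : g * g' = g' * g := by
  obtain ⟨e⟩ := nonempty_specialLefschetzGroup_mulEquiv_pi_units hA hθ
  have h := mul_comm (e ⟨g, hg⟩) (e ⟨g', hg'⟩)
  rw [← map_mul, ← map_mul] at h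
  exact congrArg Subtype.val (e.injective h)

end SpecialLefschetz

/-! ### §3 `L(A)(ℂ)` is the torus `T^Ψ(ℂ) = {d | d_σ d_σ̄ = c} ≅ (ℂˣ)^Φ × ℂˣ`; `l = c` -/

section Lefschetz

variable [IsCMField K]

/-- A square root in `ℂˣ`. [folklore] -/
private theorem exists_units_mul_self_eq (c : ℂˣ) : ∃ c₀ : ℂˣ, c₀ * c₀ = c := by
  obtain ⟨z, hz⟩ := IsAlgClosed.exists_eq_mul_self (c : ℂ)
  have hz0 : z ≠ 0 := fun h ↦ c.ne_zero (by rw [hz, h, mul_zero])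
  exact ⟨Units.mk0 z hz0, Units.ext (by rw [Units.val_mul, Units.val_mk0, ← hz])⟩

/-- **The degree-one component of `g ∈ L(A)(ℂ)` is diagonal with `d_σ d_σ̄ = c` INDEPENDENT of `σ`** (`c ∈ ℂˣ` = Milne's
multiplier `l(g) = γ†γ`): `g = w(c₀)·s` with `s ∈ ker l` (`L = w(𝔾_m)·ker l`), `g₁ = c₀ s₁`, `c = c₀²`. No hypothesis on `θ(K)`.
[cite: Milne1999, §1 Rem. 1.10 (L₀(A)) and §2 Prop. 2.5] [cite: Milne1999LefschetzClasses, Def. 4.3, Thm. 4.4, p. 659] -/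
theorem exists_eigenvalues_multiplier_of_mem_lefschetzGroup (hA : IsCMTypeRealisation Φ A ι θ)
    (hv : ∀ (σ : K →+* ℂ) (a : K), θ a (v σ) = σ a • v σ)
    {g : ∀ k : ℕ, complexBetti A.X k ≃ₗ[ℂ] complexBetti A.X k} (hg : g ∈ lefschetzGroup A.dim A.X) :
    ∃ (d : (K →+* ℂ) → ℂˣ) (c : ℂˣ), (∀ σ, g 1 (v σ) = (d σ : ℂ) • v σ) ∧ ∀ σ, d σ * d (conjugate σ) = c := by
  obtain ⟨c₀, s, hs, rfl⟩ := mem_lefschetzGroup_iff_exists_weightCocharacter_mul.1 hg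
  obtain ⟨d, hd, h1⟩ := exists_eigenvalues_of_mem_specialLefschetzGroup hA hv hs
  refine ⟨fun σ ↦ c₀ * d σ, c₀ * c₀, fun σ ↦ ?_, fun σ ↦ Units.ext ?_⟩
  · rw [weightCocharacter_mul_apply_one, LinearEquiv.mul_apply, hd, map_smul, smulOfUnit_apply_eq, smul_smul,
      Units.val_mul, mul_comm (d σ : ℂ)]
  · simp only [Units.val_mul]
    calc (c₀ : ℂ) * d σ * (c₀ * d (conjugate σ)) = c₀ * c₀ * ((d σ : ℂ) * d (conjugate σ)) := by ring
      _ = c₀ * c₀ := by rw [h1 σ, mul_one]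

/-- **The multiplier is Milne's character `l`**: if `g ∈ L(A)(ℂ)` has eigenvalues `d` with `d_σ d_σ̄ = c`, then
`Q_h(g₁x, g₁y) = c · Q_h(x, y)` for every class `h` whose Rosati involution is complex conjugation on `K` («its canonical
character `l(A_Ψ)` sends `α` to `α · ια`»; proof of Thm. 4.4: `e_D(γx, γy) = γ†γ · e_D(x, y)`).
[cite: Milne1999, §2 Prop. 2.5] [cite: Milne1999LefschetzClasses, Thm. 4.4 (proof, p. 659)] -/
theorem polarizationPairingOne_eq_multiplier_smul_of_eigenvalues (hA : IsCMTypeRealisation Φ A ι θ)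
    (hv : ∀ (σ : K →+* ℂ) (a : K), θ a (v σ) = σ a • v σ) {h : complexBetti A.X 2}
    (hros : ∀ (a ac : 𝓞 K), (ac : K) = IsCMField.complexConj K (a : K) → ∀ x y : complexBetti A.X 1,
      polarizationPairingOne A.X h (A.dim - 1) (complexBetti.map (ι a).hom.hom.hom 1 x) y =
        polarizationPairingOne A.X h (A.dim - 1) x (complexBetti.map (ι ac).hom.hom.hom 1 y))
    {u : complexBetti A.X 1 ≃ₗ[ℂ] complexBetti A.X 1} {d : (K →+* ℂ) → ℂ} (hd : ∀ σ, u (v σ) = d σ • v σ) {c : ℂ}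
    (hc : ∀ σ, d σ * d (conjugate σ) = c) (x y : complexBetti A.X 1) :
    polarizationPairingOne A.X h (A.dim - 1) (u x) (u y) = c • polarizationPairingOne A.X h (A.dim - 1) x y :=
  polarizationPairingOne_map_map_of_eigenvalues (hA.map_ringOfIntegers_basis_eq_smul hv) hros hd hc x y

/-- **Conversely, a diagonal automorphism with `d_σ d_σ̄ = c ∈ ℂˣ` constant is the degree-one component of an element of
`L(A)(ℂ)`** (`θ(K) ⊆ C(A)`): `d = c₀ · d'` with `c₀² = c`, `d'` unitary, so `u = c₀ · u'` with `u' ∈ ker l(A)|_{H¹}` and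
`c₀ · 1 = w(c₀)₁ ∈ L(A)|_{H¹}`. [cite: Milne1999, §1 Rem. 1.10 and §2 Prop. 2.5] [cite: Milne1999LefschetzClasses, p. 659 (L = w·ker l)] -/
theorem mem_map_lefschetzGroup_one_of_eigenvalues (hA : IsCMTypeRealisation Φ A ι θ)
    (hθ : ∀ a : K, θ a ∈ centralizerAlgebra A) (hv : ∀ (σ : K →+* ℂ) (a : K), θ a (v σ) = σ a • v σ)
    {u : complexBetti A.X 1 ≃ₗ[ℂ] complexBetti A.X 1} {d : (K →+* ℂ) → ℂ} (hd : ∀ σ, u (v σ) = d σ • v σ) {c : ℂˣ}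
    (hc : ∀ σ, d σ * d (conjugate σ) = c) :
    u ∈ (lefschetzGroup A.dim A.X).map (Pi.evalMonoidHom (fun k : ℕ ↦ complexBetti A.X k ≃ₗ[ℂ] complexBetti A.X k) 1) := by
  obtain ⟨c₀, hc₀⟩ := exists_units_mul_self_eq c
  -- `u' = c₀⁻¹ u` is diagonal with unitary eigenvalues
  set u' : complexBetti A.X 1 ≃ₗ[ℂ] complexBetti A.X 1 := LinearEquiv.smulOfUnit c₀⁻¹ * u with hu'
  have hd' : ∀ σ, u' (v σ) = ((c₀⁻¹ : ℂˣ) * d σ : ℂ) • v σ := fun σ ↦ by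
    rw [hu', LinearEquiv.mul_apply, hd, smulOfUnit_apply_eq, smul_smul]
  have h1 : ∀ σ, ((c₀⁻¹ : ℂˣ) * d σ : ℂ) * ((c₀⁻¹ : ℂˣ) * d (conjugate σ)) = 1 := fun σ ↦ by
    have e0 : ((c₀⁻¹ : ℂˣ) : ℂ) * (c₀⁻¹ : ℂˣ) * (c : ℂ) = 1 := by
      rw [← hc₀, Units.val_mul, ← Units.val_mul, ← Units.val_mul, ← Units.val_mul]
      simp
    calc ((c₀⁻¹ : ℂˣ) * d σ : ℂ) * ((c₀⁻¹ : ℂˣ) * d (conjugate σ))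
        = ((c₀⁻¹ : ℂˣ) : ℂ) * (c₀⁻¹ : ℂˣ) * (d σ * d (conjugate σ)) := by ring
      _ = 1 := by rw [hc σ, e0]
  have hu'mem := mem_map_specialLefschetzGroup_one_of_eigenvalues hA hθ hv hd' h1
  have hu : u = LinearEquiv.smulOfUnit c₀ * u' := by
    rw [hu', ← mul_assoc]
    refine LinearEquiv.ext fun x ↦ ?_
    rw [LinearEquiv.mul_apply, LinearEquiv.mul_apply, smulOfUnit_apply_eq, smulOfUnit_apply_eq, smul_smul,
      ← Units.val_mul, mul_inv_cancel, Units.val_one, one_smul]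
  rw [hu]
  exact mul_mem (smulOfUnit_mem_lefschetzGroup_map_one c₀)
    (Subgroup.map_mono specialLefschetzGroup_le_lefschetzGroup hu'mem)

/-- **Milne 1999b Prop. 2.5 on `ℂ`-points: `L(A_Ψ) = T^Ψ`, `T^Ψ = {α | α · ια ∈ 𝔾_m}`** — a diagonal automorphism
`u = diag(d_σ)` of `H¹(A(ℂ); ℂ)` is the degree-one component of an element of the Lefschetz group `L(A)(ℂ)` iff
`d_σ d_σ̄ = c` is independent of `σ` (`θ(K) ⊆ C(A)`). [cite: Milne1999, §2 Prop. 2.5 («L(A_Ψ)(ℚ) = {α ∈ E_ψ^× | α · ια ∈ ℚ^×}»)]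
[cite: Milne1999LefschetzClasses, Def. 4.3, Thm. 4.4 (p. 659)] -/
theorem mem_map_lefschetzGroup_one_iff_of_eigenvalues (hA : IsCMTypeRealisation Φ A ι θ)
    (hθ : ∀ a : K, θ a ∈ centralizerAlgebra A) (hv : ∀ (σ : K →+* ℂ) (a : K), θ a (v σ) = σ a • v σ)
    {u : complexBetti A.X 1 ≃ₗ[ℂ] complexBetti A.X 1} {d : (K →+* ℂ) → ℂ} (hd : ∀ σ, u (v σ) = d σ • v σ) :
    u ∈ (lefschetzGroup A.dim A.X).map (Pi.evalMonoidHom (fun k : ℕ ↦ complexBetti A.X k ≃ₗ[ℂ] complexBetti A.X k) 1) ↔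
      ∃ c : ℂˣ, ∀ σ, d σ * d (conjugate σ) = c := by
  constructor
  · rintro ⟨g, hg, rfl⟩
    obtain ⟨d', c, hd', hc⟩ := exists_eigenvalues_multiplier_of_mem_lefschetzGroup hA hv hg
    refine ⟨c, fun σ ↦ ?_⟩
    have e : ∀ τ, d τ = d' τ := fun τ ↦ eigenvalue_eq_of_eq hd hd' τ
    rw [e, e, ← Units.val_mul, hc]
  · rintro ⟨c, hc⟩
    exact mem_map_lefschetzGroup_one_of_eigenvalues hA hθ hv hd hc

/-- **Every similitude eigenvalue system is realised by exactly one element of `L(A)(ℂ)`** (`θ(K) ⊆ C(A)`; uniqueness: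
`L(A)` is faithful on `H¹`, `lefschetzGroup_ext_one'`). [cite: Milne1999, §2 Prop. 2.5] [cite: Milne1999LefschetzClasses, Def. 4.3 and Thm. 4.4] -/
theorem existsUnique_mem_lefschetzGroup_of_eigenvalues (hA : IsCMTypeRealisation Φ A ι θ)
    (hθ : ∀ a : K, θ a ∈ centralizerAlgebra A) (hv : ∀ (σ : K →+* ℂ) (a : K), θ a (v σ) = σ a • v σ)
    (d : (K →+* ℂ) → ℂˣ) {c : ℂˣ} (hc : ∀ σ, d σ * d (conjugate σ) = c) :
    ∃! g : ∀ k : ℕ, complexBetti A.X k ≃ₗ[ℂ] complexBetti A.X k,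
      g ∈ lefschetzGroup A.dim A.X ∧ ∀ σ, g 1 (v σ) = (d σ : ℂ) • v σ := by
  obtain ⟨D, hD⟩ := exists_eigenbasisDiagonalHom v
  have hc' : ∀ σ, (d σ : ℂ) * d (conjugate σ) = c := fun σ ↦ by rw [← Units.val_mul, hc]
  obtain ⟨g, hg, hg1⟩ := mem_map_lefschetzGroup_one_of_eigenvalues hA hθ hv (hD d) hc'
  refine ⟨g, ⟨hg, fun σ ↦ by rw [show g 1 = D d from hg1, hD]⟩, ?_⟩
  rintro g' ⟨hg', hd'⟩
  refine lefschetzGroup_ext_one' hg' hg ?_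
  rw [show g 1 = D d from hg1]
  exact eq_of_apply_basis_eq_smul hd' (hD d)

/-- **`(d|_Φ, c)` are free coordinates on `L(A)(ℂ)`**: for every `e : Φ → ℂˣ` and `c ∈ ℂˣ` there is exactly one
`g ∈ L(A)(ℂ)` with `g₁ v_φ = e_φ v_φ` (`φ ∈ Φ`) and `g₁ v_φ̄ = c e_φ⁻¹ v_φ̄` — the torus `T^Ψ` has dimension `|Φ| + 1`.
[cite: Milne1999, §2 Prop. 2.5] [cite: Milne1999LefschetzClasses, §3 p. 657] -/
theorem existsUnique_mem_lefschetzGroup_of_cmType (hA : IsCMTypeRealisation Φ A ι θ)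
    (hθ : ∀ a : K, θ a ∈ centralizerAlgebra A) (hv : ∀ (σ : K →+* ℂ) (a : K), θ a (v σ) = σ a • v σ)
    (e : Φ.1 → ℂˣ) (c : ℂˣ) :
    ∃! g : ∀ k : ℕ, complexBetti A.X k ≃ₗ[ℂ] complexBetti A.X k,
      g ∈ lefschetzGroup A.dim A.X ∧ (∀ φ : Φ.1, g 1 (v φ) = (e φ : ℂ) • v φ) ∧
        ∀ φ : Φ.1, g 1 (v (conjugate φ)) = ((c * (e φ)⁻¹ : ℂˣ) : ℂ) • v (conjugate φ) := by
  classical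
  -- the `c`-similitude extension of `e`
  let d : (K →+* ℂ) → ℂˣ := fun σ ↦
    if hσ : σ ∈ Φ.1 then e ⟨σ, hσ⟩ else c * (e ⟨conjugate σ, conjugate_mem_of_not_mem Φ hσ⟩)⁻¹
  have hdΦ : ∀ φ : Φ.1, d φ = e φ := fun φ ↦ by
    simp only [d, dif_pos φ.2]
  have hdc : ∀ (φ : K →+* ℂ) (hφ : φ ∈ Φ.1), d (conjugate φ) = c * (e ⟨φ, hφ⟩)⁻¹ := fun φ hφ ↦ by
    simp only [d, dif_neg (conjugate_not_mem_of_mem Φ hφ)]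
    congr 4
    exact NumberField.ComplexEmbedding.involutive_conjugate K φ
  have hc : ∀ σ, d σ * d (conjugate σ) = c := fun σ ↦ by
    by_cases hσ : σ ∈ Φ.1
    · rw [hdc σ hσ, show d σ = e ⟨σ, hσ⟩ from hdΦ ⟨σ, hσ⟩, mul_left_comm, mul_inv_cancel, mul_one]
    · have hσ' := conjugate_mem_of_not_mem Φ hσ
      have e1 : d σ = c * (e ⟨conjugate σ, hσ'⟩)⁻¹ := by simp only [d, dif_neg hσ]
      rw [e1, show d (conjugate σ) = e ⟨conjugate σ, hσ'⟩ from hdΦ ⟨conjugate σ, hσ'⟩, mul_assoc, inv_mul_cancel,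
        mul_one]
  obtain ⟨g, ⟨hg, hgd⟩, huniq⟩ := existsUnique_mem_lefschetzGroup_of_eigenvalues hA hθ hv d hc
  refine ⟨g, ⟨hg, fun φ ↦ by rw [hgd, hdΦ], fun φ ↦ by rw [hgd, hdc φ.1 φ.2]⟩, ?_⟩
  rintro g' ⟨hg', he', hec'⟩
  refine huniq g' ⟨hg', fun σ ↦ ?_⟩
  by_cases hσ : σ ∈ Φ.1
  · rw [he' ⟨σ, hσ⟩, ← hdΦ ⟨σ, hσ⟩]
  · have hσ' := conjugate_mem_of_not_mem Φ hσ
    have e1 := hec' ⟨conjugate σ, hσ'⟩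
    have e2 : conjugate (conjugate σ) = σ := NumberField.ComplexEmbedding.involutive_conjugate K σ
    simp only [e2] at e1
    rw [e1]
    congr 2
    simp only [d, dif_neg hσ]

/-- **`L(A)(ℂ) ≅ (ℂˣ)^Φ × ℂˣ` as groups: Milne 1999b Prop. 2.5, `(L(A_Ψ), l(A_Ψ)) = (T^Ψ, t^Ψ)`, on `ℂ`-points for the
family carrier `lefschetzGroup (dim A) A.X`** — the coordinates being the eigenvalues on `Φ` and the multiplier `l = c`
(`θ(K) ⊆ C(A)`). [cite: Milne1999, §2 Prop. 2.5] [cite: Milne1999LefschetzClasses, Def. 4.3, Thm. 4.4, §3 p. 657] -/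
theorem nonempty_lefschetzGroup_mulEquiv_pi_units_prod (hA : IsCMTypeRealisation Φ A ι θ)
    (hθ : ∀ a : K, θ a ∈ centralizerAlgebra A) : Nonempty (lefschetzGroup A.dim A.X ≃* (Φ.1 → ℂˣ) × ℂˣ) := by
  classical
  obtain ⟨v, hv, -⟩ := Deligne1982.exists_eigenbasis_of_isCMTypeRealisation hA
  have hA1 := one_le_dim hA
  -- a member `φ₀ ∈ Φ` (to read off the multiplier)
  have hne : Φ.1.Nonempty := Set.nonempty_of_ncard_ne_zero (by rw [hA.ncard_cmType_eq_dim]; omega)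
  obtain ⟨φ₀, hφ₀⟩ := hne
  choose G hG huniq using fun ec : (Φ.1 → ℂˣ) × ℂˣ ↦ existsUnique_mem_lefschetzGroup_of_cmType hA hθ hv ec.1 ec.2
  -- coordinates of an element of `L(A)(ℂ)`: eigenvalues on `Φ` and the multiplier
  have hev : ∀ g ∈ lefschetzGroup A.dim A.X, ∃ ec : (Φ.1 → ℂˣ) × ℂˣ, (∀ φ : Φ.1, g 1 (v φ) = (ec.1 φ : ℂ) • v φ) ∧
      ∀ φ : Φ.1, g 1 (v (conjugate φ)) = ((ec.2 * (ec.1 φ)⁻¹ : ℂˣ) : ℂ) • v (conjugate φ) := fun g hg ↦ by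
    obtain ⟨d, c, hd, hc⟩ := exists_eigenvalues_multiplier_of_mem_lefschetzGroup hA hv hg
    refine ⟨(fun φ ↦ d φ, c), fun φ ↦ hd φ, fun φ ↦ ?_⟩
    rw [hd]
    congr 2
    rw [eq_comm, mul_inv_eq_iff_eq_mul, mul_comm]
    exact (hc φ).symm
  choose E hE hE' using hev
  have hGE : ∀ g (hg : g ∈ lefschetzGroup A.dim A.X), G (E g hg) = g := fun g hg ↦
    (huniq (E g hg) g ⟨hg, hE g hg, hE' g hg⟩).symm
  -- reading coordinates off a `G ec`
  have hcoord : ∀ (g) (hg : g ∈ lefschetzGroup A.dim A.X) (ec : (Φ.1 → ℂˣ) × ℂˣ),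
      (∀ φ : Φ.1, g 1 (v φ) = (ec.1 φ : ℂ) • v φ) →
      (∀ φ : Φ.1, g 1 (v (conjugate φ)) = ((ec.2 * (ec.1 φ)⁻¹ : ℂˣ) : ℂ) • v (conjugate φ)) → E g hg = ec := by
    intro g hg ec h1 h2
    have he : (E g hg).1 = ec.1 := funext fun φ ↦
      Units.ext (smul_left_injective ℂ (v.ne_zero φ) (((hE g hg) φ).symm.trans (h1 φ)))
    refine Prod.ext he ?_
    have e1 := ((hE' g hg) ⟨φ₀, hφ₀⟩).symm.trans (h2 ⟨φ₀, hφ₀⟩)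
    have e2 : (E g hg).2 * ((E g hg).1 ⟨φ₀, hφ₀⟩)⁻¹ = ec.2 * (ec.1 ⟨φ₀, hφ₀⟩)⁻¹ :=
      Units.ext (smul_left_injective ℂ (v.ne_zero _) e1)
    rwa [he, mul_left_inj] at e2
  have hEG : ∀ ec : (Φ.1 → ℂˣ) × ℂˣ, E (G ec) (hG ec).1 = ec := fun ec ↦
    hcoord _ _ ec (hG ec).2.1 (hG ec).2.2
  let F : (Φ.1 → ℂˣ) × ℂˣ →* lefschetzGroup A.dim A.X :=
    { toFun := fun ec ↦ ⟨G ec, (hG ec).1⟩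
      map_one' := Subtype.ext (by
        have h1 : (1 : ∀ k : ℕ, complexBetti A.X k ≃ₗ[ℂ] complexBetti A.X k) ∈ lefschetzGroup A.dim A.X := one_mem _
        show G 1 = 1
        rw [← hGE 1 h1]
        congr 1
        refine (hcoord 1 h1 1 (fun φ ↦ ?_) (fun φ ↦ ?_)).symm
        · show (1 : complexBetti A.X 1 ≃ₗ[ℂ] complexBetti A.X 1) (v φ) = ((1 : ℂˣ) : ℂ) • v φ
          rw [Units.val_one, one_smul]
          rfl
        · show (1 : complexBetti A.X 1 ≃ₗ[ℂ] complexBetti A.X 1) (v (conjugate φ)) =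
            ((1 * 1⁻¹ : ℂˣ) : ℂ) • v (conjugate φ)
          rw [inv_one, mul_one, Units.val_one, one_smul]
          rfl)
      map_mul' := fun ec ec' ↦ Subtype.ext (by
        have hm : G ec * G ec' ∈ lefschetzGroup A.dim A.X := mul_mem (hG ec).1 (hG ec').1
        show G (ec * ec') = G ec * G ec'
        rw [← hGE (G ec * G ec') hm]
        congr 1
        refine (hcoord _ hm (ec * ec') (fun φ ↦ ?_) (fun φ ↦ ?_)).symm
        · rw [Pi.mul_apply, LinearEquiv.mul_apply, (hG ec').2.1, map_smul, (hG ec).2.1, smul_smul, Prod.fst_mul,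
            Pi.mul_apply, Units.val_mul, mul_comm ((ec'.1 φ : ℂˣ) : ℂ)]
        · rw [Pi.mul_apply, LinearEquiv.mul_apply, (hG ec').2.2, map_smul, (hG ec).2.2, smul_smul, ← Units.val_mul]
          congr 2
          rw [Prod.snd_mul, Prod.fst_mul, Pi.mul_apply, mul_inv]
          simp only [mul_assoc, mul_left_comm, mul_comm]) }
  refine ⟨(MulEquiv.ofBijective F ⟨fun ec ec' h ↦ ?_, fun g ↦ ⟨E g.1 g.2, Subtype.ext (hGE g.1 g.2)⟩⟩).symm⟩
  have h' : G ec = G ec' := congrArg Subtype.val h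
  have key := hcoord (G ec) (hG ec).1 ec' (fun φ ↦ by rw [h']; exact (hG ec').2.1 φ)
    (fun φ ↦ by rw [h']; exact (hG ec').2.2 φ)
  rwa [hEG ec] at key

/-- **`L(A)(ℂ) ≅ (ℂˣ)^{dim A} × ℂˣ`: the Lefschetz group of a CM abelian variety is a torus of dimension `g + 1`.**
[cite: Milne1999, §2 Prop. 2.5] [cite: Milne1999LefschetzClasses, §3 p. 657] -/
theorem nonempty_lefschetzGroup_mulEquiv_fin_prod (hA : IsCMTypeRealisation Φ A ι θ)
    (hθ : ∀ a : K, θ a ∈ centralizerAlgebra A) : Nonempty (lefschetzGroup A.dim A.X ≃* (Fin A.dim → ℂˣ) × ℂˣ) := by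
  obtain ⟨e⟩ := nonempty_lefschetzGroup_mulEquiv_pi_units_prod hA hθ
  haveI : Finite Φ.1 := Set.toFinite Φ.1
  have hcard : Nat.card Φ.1 = A.dim := by rw [Nat.card_coe_set_eq, hA.ncard_cmType_eq_dim]
  exact ⟨e.trans (MulEquiv.prodCongr
    (MulEquiv.arrowCongr ((Finite.equivFin Φ.1).trans (finCongr hcard)) (MulEquiv.refl ℂˣ)) (MulEquiv.refl ℂˣ))⟩

/-- `L(A)(ℂ)` of a CM realisation is commutative (a torus; cf. `lefschetzGroup_comm_iff_isOfCMType`).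
[cite: Milne1999, §1 Rem. 1.10 («π(A) is commutative») and §2 Prop. 2.5] -/
theorem lefschetzGroup_comm_of_isCMTypeRealisation (hA : IsCMTypeRealisation Φ A ι θ)
    (hθ : ∀ a : K, θ a ∈ centralizerAlgebra A) {g g' : ∀ k : ℕ, complexBetti A.X k ≃ₗ[ℂ] complexBetti A.X k}
    (hg : g ∈ lefschetzGroup A.dim A.X) (hg' : g' ∈ lefschetzGroup A.dim A.X) : g * g' = g' * g := by
  obtain ⟨e⟩ := nonempty_lefschetzGroup_mulEquiv_pi_units_prod hA hθ
  have h := mul_comm (e ⟨g, hg⟩) (e ⟨g', hg'⟩)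
  rw [← map_mul, ← map_mul] at h
  exact congrArg Subtype.val (e.injective h)

/-- The same statements with `θ(K) ⊆ C(A)` derived from a COMMUTATIVE `End(A)` (e.g. `A` simple of CM type):
`ker l(A)(ℂ) ≅ (ℂˣ)^{dim A}` and `L(A)(ℂ) ≅ (ℂˣ)^{dim A} × ℂˣ`. [cite: Milne1999, §2 Prop. 2.5 and p. 54]
[cite: Milne1999LefschetzClasses, §3 p. 657] -/
theorem nonempty_lefschetzGroup_mulEquiv_fin_prod_of_comm (hA : IsCMTypeRealisation Φ A ι θ)
    (hcomm : ∀ f g : A ⟶ A, f ≫ g = g ≫ f) :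
    Nonempty (specialLefschetzGroup A.dim A.X ≃* (Fin A.dim → ℂˣ)) ∧
      Nonempty (lefschetzGroup A.dim A.X ≃* (Fin A.dim → ℂˣ) × ℂˣ) :=
  ⟨nonempty_specialLefschetzGroup_mulEquiv_fin hA (hA.theta_mem_centralizerAlgebra_of_comm hcomm),
    nonempty_lefschetzGroup_mulEquiv_fin_prod hA (hA.theta_mem_centralizerAlgebra_of_comm hcomm)⟩

end Lefschetz

end Literature.AlgebraicGeometry.Milne1999

end
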